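import Mathlib
import Literature.NumberTheory.Transcendental.AssociatorsMainLemmaProofs
import Literature.NumberTheory.Transcendental.DrinfeldAssociatorProofs
import HarnessLib

/-!
# Associators XI: cabling maps and the pentagon coherence identity for a moving strand

Proofs file towards [Furusho2010, Thm 1] (`furusho_pentagon_hexagon`), first step of the
inductive "cocycle" argument (the hexagon defect of a pentagon solution in its lowest degree is a
2-cocycle of the free-algebra functor, hence vanishes in degree `≥ 3`). Here: the part of that
argument which uses ONLY the pentagon equation.

1. **Cabling maps** `DrinfeldKohnoTrunc.cableHom`: for pairwise disjoint blocks `c i ⊆ ι` the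
   assignment `t i j ↦ t_{c i, c j} := Σ_{a ∈ c i, b ∈ c j} t a b` respects the infinitesimal braid
   relations (the cabling/doubling morphisms `𝔞_n → 𝔞_m` of [Drinfeld1991, §4–5], including the
   removal of strands, `c i = ∅`), whence algebra endomorphisms of `U𝔞₄ ⊗ k/(deg > N)`; the two
   instances used later are `d₀` (`0 ↦ {0,1}, 1 ↦ 2, 2 ↦ 3, 3 ↦ ∅`) and `d₁`
   (`0 ↦ 0, 1 ↦ {1,2}, 2 ↦ 3, 3 ↦ ∅`).
2. **Permuted pentagons** `NCSeries.DrinfeldPentagon.perm`: the image of the pentagon under the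
   `S₄`-action, `Φ^{P,Q,RS} Φ^{PQ,R,S} = Φ^{Q,R,S} Φ^{P,QR,S} Φ^{P,Q,R}` for every ordering
   `(P,Q,R,S)` of the four strands (`Φ^{P,Q,S} = φ(t_{PQ}, t_{QS})`).
3. **The coherence identity** `NCSeries.DrinfeldPentagon.coherence`: for a solution `φ` of the
   pentagon with constant term `1` and any `μ`, the two ways of expressing "strand `3` moves to the
   left of the block `(01)2`" through the elementary moves `e^{μ t_{i3}/2}` and re-associations
   agree:
   `Φ^{D,AB,C} [Φ^{D,A,B} E^{AD} (Φ^{A,D,B})⁻¹ E^{BD} Φ^{A,B,D}] (Φ^{AB,D,C})⁻¹ E^{CD} Φ^{AB,C,D}`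
   `= (Φ^{A,B,C})⁻¹ Φ^{D,A,BC} E^{AD} (Φ^{A,D,BC})⁻¹ [Φ^{D,B,C} E^{BD} (Φ^{B,D,C})⁻¹ E^{CD} Φ^{B,C,D}] Φ^{A,BC,D} Φ^{A,B,C}`
   (`A,B,C,D = 0,1,2,3`, `E^{PQ} = exp{μ t_{PQ}/2}`), by four instances of the pentagon
   (Mac Lane coherence) and three infinitesimal-braid commutations; the bracketed words are the
   right-hand sides of the first hexagon equation for the blocks `(A,B|D)` and `(B,C|D)`. The
   group-theoretic core is isolated in `coherence_group`.

No named facts are introduced.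

## References

* H. Furusho, *Pentagon and hexagon equations*, Ann. of Math. 171 (2010), 545–556. [Furusho2010]
* V. G. Drinfel'd, *On quasitriangular quasi-Hopf algebras and on a group that is closely
  connected with Gal(Q̄/Q)*, Leningrad Math. J. 2 (1991), §4–5 (cabling morphisms of `𝔞_n`,
  the pentagon and hexagon as identities between them). [Drinfeld1991]
-/

noncomputable section

open scoped BigOperators

namespace Literature.NumberTheory.Transcendental

universe u v w

/-! ## 0. The group-theoretic core of the coherence identity -/

/-- **Coherence, abstractly.** In any group, the four pentagon relations
`p h = n o a`, `p g = m q f`, `j r = l q d`, `i r = a b c` and the three commutations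
`[e_{CD}, p] = [e_{BD}, q] = [e_{AD}, r] = 1` imply
`b c e_{AD} d⁻¹ e_{BD} f g⁻¹ e_{CD} h = a⁻¹ i e_{AD} j⁻¹ l e_{BD} m⁻¹ e_{CD} n o a`.
(Dictionary: `a = Φ^{A,B,C}`, `b = Φ^{D,AB,C}`, `c = Φ^{D,A,B}`, `d = Φ^{A,D,B}`, `f = Φ^{A,B,D}`,
`g = Φ^{AB,D,C}`, `h = Φ^{AB,C,D}`, `i = Φ^{D,A,BC}`, `j = Φ^{A,D,BC}`, `l = Φ^{D,B,C}`,
`m = Φ^{B,D,C}`, `n = Φ^{B,C,D}`, `o = Φ^{A,BC,D}`, `p = Φ^{A,B,CD}`, `q = Φ^{A,BD,C}`,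
`r = Φ^{AD,B,C}`.) [folklore] -/
theorem coherence_group {G : Type*} [Group G]
    {a b c d f g h i j l m n o p q r eAD eBD eCD : G}
    (pent1 : p * h = n * o * a) (pent2 : p * g = m * q * f) (pent3 : j * r = l * q * d)
    (pent4 : i * r = a * b * c) (c2 : eCD * p = p * eCD) (c4 : eBD * q = q * eBD)
    (c6 : eAD * r = r * eAD) :
    b * c * eAD * d⁻¹ * eBD * f * g⁻¹ * eCD * h =
      a⁻¹ * i * eAD * j⁻¹ * l * eBD * m⁻¹ * eCD * n * o * a := by
  have hn : n = p * h * a⁻¹ * o⁻¹ := by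
    rw [eq_mul_inv_iff_mul_eq, eq_mul_inv_iff_mul_eq]; exact pent1.symm
  have hm : m = p * g * f⁻¹ * q⁻¹ := by
    rw [eq_mul_inv_iff_mul_eq, eq_mul_inv_iff_mul_eq]; exact pent2.symm
  have hl : l = j * r * d⁻¹ * q⁻¹ := by
    rw [eq_mul_inv_iff_mul_eq, eq_mul_inv_iff_mul_eq]; exact pent3.symm
  have hi : i = a * b * c * r⁻¹ := by
    rw [eq_mul_inv_iff_mul_eq]; exact pent4
  have c2r : ∀ X : G, p⁻¹ * (eCD * (p * X)) = eCD * X := fun X => by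
    calc p⁻¹ * (eCD * (p * X)) = p⁻¹ * ((eCD * p) * X) := by simp only [mul_assoc]
      _ = p⁻¹ * ((p * eCD) * X) := by rw [c2]
      _ = eCD * X := by simp only [mul_assoc, inv_mul_cancel_left]
  have c4r : ∀ X : G, q⁻¹ * (eBD * (q * X)) = eBD * X := fun X => by
    calc q⁻¹ * (eBD * (q * X)) = q⁻¹ * ((eBD * q) * X) := by simp only [mul_assoc]
      _ = q⁻¹ * ((q * eBD) * X) := by rw [c4]
      _ = eBD * X := by simp only [mul_assoc, inv_mul_cancel_left]
  have c6r : ∀ X : G, r⁻¹ * (eAD * (r * X)) = eAD * X := fun X => by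
    calc r⁻¹ * (eAD * (r * X)) = r⁻¹ * ((eAD * r) * X) := by simp only [mul_assoc]
      _ = r⁻¹ * ((r * eAD) * X) := by rw [c6]
      _ = eAD * X := by simp only [mul_assoc, inv_mul_cancel_left]
  rw [hn, hm, hl, hi]
  simp only [mul_inv_rev, inv_inv, mul_assoc, inv_mul_cancel_left, inv_mul_cancel, mul_one, c2r,
    c4r, c6r]

/-! ## 1. Cabling maps -/

namespace DrinfeldKohnoTrunc

section Cabling

variable {R : Type u} [CommRing R] {ι : Type v} {N : ℕ}

variable (R N) in
/-- The chord between two blocks of strands: `t_{A,B} = Σ_{a ∈ A} Σ_{b ∈ B} t a b`.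
[cite: Drinfeld1991, §5] -/
def tBlock (A B : Finset ι) : DrinfeldKohnoTrunc R ι N := ∑ a ∈ A, ∑ b ∈ B, t R N a b

/-- Block chords are weight-one. [folklore] -/
theorem tBlock_mem_genSpan (A B : Finset ι) :
    tBlock R N A B ∈ (genSpan : Submodule R (DrinfeldKohnoTrunc R ι N)) :=
  Submodule.sum_mem _ fun a _ => Submodule.sum_mem _ fun b _ => t_mem_genSpan a b

/-- `t_{A,B} = t_{B,A}`. [folklore] -/
theorem tBlock_comm (A B : Finset ι) : tBlock R N A B = tBlock R N B A := by
  unfold tBlock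
  rw [Finset.sum_comm]
  exact Finset.sum_congr rfl fun b _ => Finset.sum_congr rfl fun a _ => t_symm a b

/-- **The infinitesimal braid relation for blocks**: for pairwise disjoint `A, B, C`,
`[t_{A,B}, t_{A,C} + t_{B,C}] = 0`. [cite: Drinfeld1991, §5] -/
theorem commute_tBlock_add {A B C : Finset ι} (hAB : Disjoint A B) (hAC : Disjoint A C)
    (hBC : Disjoint B C) :
    Commute (tBlock R N A B) (tBlock R N A C + tBlock R N B C) := by
  classical
  have hS : tBlock R N A C + tBlock R N B C =
      ∑ c ∈ C, (∑ a ∈ A, t R N a c + ∑ b ∈ B, t R N b c) := by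
    unfold tBlock
    rw [Finset.sum_comm (s := A), Finset.sum_comm (s := B), ← Finset.sum_add_distrib]
  rw [hS]
  refine Commute.sum_right _ _ _ fun c hc => ?_
  unfold tBlock
  refine Commute.sum_left _ _ _ fun a ha => Commute.sum_left _ _ _ fun b hb => ?_
  have hab : a ≠ b := fun e => Finset.disjoint_left.mp hAB ha (e ▸ hb)
  have hac : a ≠ c := fun e => Finset.disjoint_left.mp hAC ha (e ▸ hc)
  have hbc : b ≠ c := fun e => Finset.disjoint_left.mp hBC hb (e ▸ hc)
  rw [← Finset.add_sum_erase A _ ha, ← Finset.add_sum_erase B _ hb]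
  have key : Commute (t R N a b) (t R N a c + t R N b c) := t_mul_add a b c hab hbc hac
  have hA' : Commute (t R N a b) (∑ x ∈ A.erase a, t R N x c) :=
    Commute.sum_right _ _ _ fun a' ha' => by
      have ha'A : a' ∈ A := Finset.mem_of_mem_erase ha'
      have ha'a : a' ≠ a := Finset.ne_of_mem_erase ha'
      exact t_comm a b a' c hab (Ne.symm ha'a) hac
        (fun e => Finset.disjoint_left.mp hAB ha'A (e ▸ hb)) hbc
        (fun e => Finset.disjoint_left.mp hAC ha'A (e ▸ hc))
  have hB' : Commute (t R N a b) (∑ x ∈ B.erase b, t R N x c) :=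
    Commute.sum_right _ _ _ fun b' hb' => by
      have hb'B : b' ∈ B := Finset.mem_of_mem_erase hb'
      have hb'b : b' ≠ b := Finset.ne_of_mem_erase hb'
      exact t_comm a b b' c hab (fun e => Finset.disjoint_left.mp hAB ha (e ▸ hb'B))
        hac (Ne.symm hb'b) hbc (fun e => Finset.disjoint_left.mp hBC hb'B (e ▸ hc))
  have e : t R N a c + ∑ x ∈ A.erase a, t R N x c + (t R N b c + ∑ x ∈ B.erase b, t R N x c) =
      (t R N a c + t R N b c) + (∑ x ∈ A.erase a, t R N x c + ∑ x ∈ B.erase b, t R N x c) := by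
    abel
  rw [e]
  exact key.add_right (hA'.add_right hB')

/-- **Locality for blocks**: `[t_{A,B}, t_{C,D}] = 0` for pairwise disjoint `A, B, C, D`.
[cite: Drinfeld1991, §5] -/
theorem commute_tBlock_tBlock {A B C D : Finset ι} (hAB : Disjoint A B) (hAC : Disjoint A C)
    (hAD : Disjoint A D) (hBC : Disjoint B C) (hBD : Disjoint B D) (hCD : Disjoint C D) :
    Commute (tBlock R N A B) (tBlock R N C D) := by
  unfold tBlock
  refine Commute.sum_left _ _ _ fun a ha => Commute.sum_left _ _ _ fun b hb => ?_
  refine Commute.sum_right _ _ _ fun c hc => Commute.sum_right _ _ _ fun d hd => ?_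
  exact t_comm a b c d (fun e => Finset.disjoint_left.mp hAB ha (e ▸ hb))
    (fun e => Finset.disjoint_left.mp hAC ha (e ▸ hc))
    (fun e => Finset.disjoint_left.mp hAD ha (e ▸ hd))
    (fun e => Finset.disjoint_left.mp hBC hb (e ▸ hc))
    (fun e => Finset.disjoint_left.mp hBD hb (e ▸ hd))
    (fun e => Finset.disjoint_left.mp hCD hc (e ▸ hd))

variable {κ : Type w} [DecidableEq κ]

variable (R N) in
/-- The images of the generators under a **cabling** `c : κ → Finset ι` (blocks of strands,
possibly empty): `t i j ↦ t_{c i, c j}` for `i ≠ j`, `t i i ↦ 0`. [cite: Drinfeld1991, §5] -/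
def cable (c : κ → Finset ι) (i j : κ) : DrinfeldKohnoTrunc R ι N :=
  if i = j then 0 else tBlock R N (c i) (c j)

/-- Off the diagonal the cable is the block chord. [folklore] -/
theorem cable_of_ne (c : κ → Finset ι) {i j : κ} (h : i ≠ j) :
    cable R N c i j = tBlock R N (c i) (c j) := if_neg h

/-- Cable values are weight-one. [folklore] -/
theorem cable_mem_genSpan (c : κ → Finset ι) (i j : κ) :
    cable R N c i j ∈ (genSpan : Submodule R (DrinfeldKohnoTrunc R ι N)) := by
  unfold cable
  split_ifs
  · exact Submodule.zero_mem _
  · exact tBlock_mem_genSpan _ _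

/-- **Cabling respects the infinitesimal braid relations** when the blocks are pairwise disjoint.
[cite: Drinfeld1991, §5] -/
theorem cable_compatible (c : κ → Finset ι) (hc : ∀ i j, i ≠ j → Disjoint (c i) (c j)) :
    Compatible N (cable R N c) where
  diag i := if_pos rfl
  symm i j := by
    by_cases h : i = j
    · subst h; rfl
    · rw [cable_of_ne c h, cable_of_ne c (Ne.symm h), tBlock_comm]
  fourTerm i j l hij hjl hil := by
    rw [cable_of_ne c hij, cable_of_ne c hil, cable_of_ne c hjl]
    exact (commute_tBlock_add (hc i j hij) (hc i l hil) (hc j l hjl)).eq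
  locality i j l m h1 h2 h3 h4 h5 h6 := by
    rw [cable_of_ne c h1, cable_of_ne c h6]
    exact (commute_tBlock_tBlock (hc i j h1) (hc i l h2) (hc i m h3) (hc j l h4) (hc j m h5)
      (hc l m h6)).eq
  trunc g := list_prod_eq_zero_of_mem_genSpan _ (fun y hy => by
    rw [List.mem_ofFn] at hy
    obtain ⟨r, rfl⟩ := hy
    exact cable_mem_genSpan c _ _) (by simp)

variable (R N) in
/-- **The cabling morphism** `U𝔞_κ ⊗ R/(deg > N) → U𝔞_ι ⊗ R/(deg > N)`, `t i j ↦ t_{c i, c j}`,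
for pairwise disjoint blocks (doubling, inserting and removing strands). [cite: Drinfeld1991, §5] -/
def cableHom (c : κ → Finset ι) (hc : ∀ i j, i ≠ j → Disjoint (c i) (c j)) :
    DrinfeldKohnoTrunc R κ N →ₐ[R] DrinfeldKohnoTrunc R ι N :=
  (cable_compatible (R := R) (N := N) c hc).lift

/-- `cableHom c (t i j) = cable c i j`. [folklore] -/
@[simp] theorem cableHom_t (c : κ → Finset ι) (hc : ∀ i j, i ≠ j → Disjoint (c i) (c j))
    (i j : κ) : cableHom R N c hc (t R N i j) = cable R N c i j :=
  (cable_compatible (R := R) (N := N) c hc).lift_t i j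

end Cabling

/-! ### The two cablings of four strands used in the coherence argument -/

section FourStrands

variable {R : Type u} [CommRing R] {N : ℕ}

/-- The cabling `0 ↦ {0,1}, 1 ↦ {2}, 2 ↦ {3}, 3 ↦ ∅` (double the first strand, drop the
last). [folklore] -/
def c₀ : Fin 4 → Finset (Fin 4) := ![{0, 1}, {2}, {3}, ∅]

/-- The cabling `0 ↦ {0}, 1 ↦ {1,2}, 2 ↦ {3}, 3 ↦ ∅` (double the second strand, drop the
last). [folklore] -/
def c₁ : Fin 4 → Finset (Fin 4) := ![{0}, {1, 2}, {3}, ∅]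

/-- Values of `c₀`. [folklore] -/
@[simp] theorem c₀_0 : c₀ 0 = {0, 1} := rfl
/-- Values of `c₀`. [folklore] -/
@[simp] theorem c₀_1 : c₀ 1 = {2} := rfl
/-- Values of `c₀`. [folklore] -/
@[simp] theorem c₀_2 : c₀ 2 = {3} := rfl
/-- Values of `c₀`. [folklore] -/
@[simp] theorem c₀_3 : c₀ 3 = ∅ := rfl
/-- Values of `c₁`. [folklore] -/
@[simp] theorem c₁_0 : c₁ 0 = {0} := rfl
/-- Values of `c₁`. [folklore] -/
@[simp] theorem c₁_1 : c₁ 1 = {1, 2} := rfl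
/-- Values of `c₁`. [folklore] -/
@[simp] theorem c₁_2 : c₁ 2 = {3} := rfl
/-- Values of `c₁`. [folklore] -/
@[simp] theorem c₁_3 : c₁ 3 = ∅ := rfl

/-- The blocks of `c₀` are pairwise disjoint. [folklore] -/
theorem c₀_disjoint : ∀ i j : Fin 4, i ≠ j → Disjoint (c₀ i) (c₀ j) := by decide

/-- The blocks of `c₁` are pairwise disjoint. [folklore] -/
theorem c₁_disjoint : ∀ i j : Fin 4, i ≠ j → Disjoint (c₁ i) (c₁ j) := by decide

variable (R N) in
/-- **`d₀`**: the algebra endomorphism of `U𝔞₄ ⊗ R/(deg > N)` doubling strand `0` into `{0,1}`,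
shifting `1, 2` to `2, 3` and removing strand `3`. [cite: Drinfeld1991, §5] -/
def d₀ : DrinfeldKohnoTrunc R (Fin 4) N →ₐ[R] DrinfeldKohnoTrunc R (Fin 4) N :=
  cableHom R N c₀ c₀_disjoint

variable (R N) in
/-- **`d₁`**: the algebra endomorphism of `U𝔞₄ ⊗ R/(deg > N)` fixing strand `0`, doubling strand
`1` into `{1,2}`, shifting `2` to `3` and removing strand `3`. [cite: Drinfeld1991, §5] -/
def d₁ : DrinfeldKohnoTrunc R (Fin 4) N →ₐ[R] DrinfeldKohnoTrunc R (Fin 4) N :=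
  cableHom R N c₁ c₁_disjoint

/-- `d₀ t₀₁ = t₀₂ + t₁₂`. [folklore] -/
@[simp] theorem d₀_t01 : d₀ R N (t R N 0 1) = t R N 0 2 + t R N 1 2 := by
  rw [d₀, cableHom_t, cable_of_ne _ (by decide)]
  simp [tBlock, Finset.sum_pair (show (0 : Fin 4) ≠ 1 by decide)]

/-- `d₀ t₀₂ = t₀₃ + t₁₃`. [folklore] -/
@[simp] theorem d₀_t02 : d₀ R N (t R N 0 2) = t R N 0 3 + t R N 1 3 := by
  rw [d₀, cableHom_t, cable_of_ne _ (by decide)]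
  simp [tBlock, Finset.sum_pair (show (0 : Fin 4) ≠ 1 by decide)]

/-- `d₀ t₁₂ = t₂₃`. [folklore] -/
@[simp] theorem d₀_t12 : d₀ R N (t R N 1 2) = t R N 2 3 := by
  rw [d₀, cableHom_t, cable_of_ne _ (by decide)]
  simp [tBlock]

/-- `d₀ t₀₃ = 0`. [folklore] -/
@[simp] theorem d₀_t03 : d₀ R N (t R N 0 3) = 0 := by
  rw [d₀, cableHom_t, cable_of_ne _ (by decide)]
  simp [tBlock]

/-- `d₀ t₁₃ = 0`. [folklore] -/
@[simp] theorem d₀_t13 : d₀ R N (t R N 1 3) = 0 := by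
  rw [d₀, cableHom_t, cable_of_ne _ (by decide)]
  simp [tBlock]

/-- `d₀ t₂₃ = 0`. [folklore] -/
@[simp] theorem d₀_t23 : d₀ R N (t R N 2 3) = 0 := by
  rw [d₀, cableHom_t, cable_of_ne _ (by decide)]
  simp [tBlock]

/-- `d₁ t₀₁ = t₀₁ + t₀₂`. [folklore] -/
@[simp] theorem d₁_t01 : d₁ R N (t R N 0 1) = t R N 0 1 + t R N 0 2 := by
  rw [d₁, cableHom_t, cable_of_ne _ (by decide)]
  simp [tBlock, Finset.sum_pair (show (1 : Fin 4) ≠ 2 by decide)]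

/-- `d₁ t₀₂ = t₀₃`. [folklore] -/
@[simp] theorem d₁_t02 : d₁ R N (t R N 0 2) = t R N 0 3 := by
  rw [d₁, cableHom_t, cable_of_ne _ (by decide)]
  simp [tBlock]

/-- `d₁ t₁₂ = t₁₃ + t₂₃`. [folklore] -/
@[simp] theorem d₁_t12 : d₁ R N (t R N 1 2) = t R N 1 3 + t R N 2 3 := by
  rw [d₁, cableHom_t, cable_of_ne _ (by decide)]
  simp [tBlock, Finset.sum_pair (show (1 : Fin 4) ≠ 2 by decide)]

/-- `d₁ t₀₃ = 0`. [folklore] -/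
@[simp] theorem d₁_t03 : d₁ R N (t R N 0 3) = 0 := by
  rw [d₁, cableHom_t, cable_of_ne _ (by decide)]
  simp [tBlock]

/-- `d₁ t₁₃ = 0`. [folklore] -/
@[simp] theorem d₁_t13 : d₁ R N (t R N 1 3) = 0 := by
  rw [d₁, cableHom_t, cable_of_ne _ (by decide)]
  simp [tBlock]

/-- `d₁ t₂₃ = 0`. [folklore] -/
@[simp] theorem d₁_t23 : d₁ R N (t R N 2 3) = 0 := by
  rw [d₁, cableHom_t, cable_of_ne _ (by decide)]
  simp [tBlock]

/-- The permutation `(2 3)` of the strands. [folklore] -/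
def s₂₃ : Equiv.Perm (Fin 4) := Equiv.swap 2 3

/-- The cyclic shift `0 ↦ 1 ↦ 2 ↦ 3 ↦ 0` of the strands. [folklore] -/
def cyc : Equiv.Perm (Fin 4) := ⟨![1, 2, 3, 0], ![3, 0, 1, 2], by decide, by decide⟩

/-- The ordering `(A,D,B,C) = (0,3,1,2)` of the strands, as a permutation. [folklore] -/
def pADBC : Equiv.Perm (Fin 4) := ⟨![0, 3, 1, 2], ![0, 2, 3, 1], by decide, by decide⟩

/-- The ordering `(D,A,B,C) = (3,0,1,2)` of the strands, as a permutation. [folklore] -/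
def pDABC : Equiv.Perm (Fin 4) := ⟨![3, 0, 1, 2], ![1, 2, 3, 0], by decide, by decide⟩

/-- Values of `s₂₃`. [folklore] -/
@[simp] theorem s₂₃_0 : s₂₃ 0 = 0 := by decide
/-- Values of `s₂₃`. [folklore] -/
@[simp] theorem s₂₃_1 : s₂₃ 1 = 1 := by decide
/-- Values of `s₂₃`. [folklore] -/
@[simp] theorem s₂₃_2 : s₂₃ 2 = 3 := by decide
/-- Values of `s₂₃`. [folklore] -/
@[simp] theorem s₂₃_3 : s₂₃ 3 = 2 := by decide
/-- Values of `cyc`. [folklore] -/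
@[simp] theorem cyc_0 : cyc 0 = 1 := rfl
/-- Values of `cyc`. [folklore] -/
@[simp] theorem cyc_1 : cyc 1 = 2 := rfl
/-- Values of `cyc`. [folklore] -/
@[simp] theorem cyc_2 : cyc 2 = 3 := rfl
/-- Values of `cyc`. [folklore] -/
@[simp] theorem cyc_3 : cyc 3 = 0 := rfl
/-- Values of `pADBC`. [folklore] -/
@[simp] theorem pADBC_0 : pADBC 0 = 0 := rfl
/-- Values of `pADBC`. [folklore] -/
@[simp] theorem pADBC_1 : pADBC 1 = 3 := rfl
/-- Values of `pADBC`. [folklore] -/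
@[simp] theorem pADBC_2 : pADBC 2 = 1 := rfl
/-- Values of `pADBC`. [folklore] -/
@[simp] theorem pADBC_3 : pADBC 3 = 2 := rfl
/-- Values of `pDABC`. [folklore] -/
@[simp] theorem pDABC_0 : pDABC 0 = 3 := rfl
/-- Values of `pDABC`. [folklore] -/
@[simp] theorem pDABC_1 : pDABC 1 = 0 := rfl
/-- Values of `pDABC`. [folklore] -/
@[simp] theorem pDABC_2 : pDABC 2 = 1 := rfl
/-- Values of `pDABC`. [folklore] -/
@[simp] theorem pDABC_3 : pDABC 3 = 2 := rfl

/-- `t i j + t i' j'` is weight-one. [folklore] -/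
theorem t_add_t_mem_genSpan (i j i' j' : Fin 4) :
    t R N i j + t R N i' j' ∈ (genSpan : Submodule R (DrinfeldKohnoTrunc R (Fin 4) N)) :=
  Submodule.add_mem _ (t_mem_genSpan i j) (t_mem_genSpan i' j')

/-- One more infinitesimal braid instance on four strands: `[t₀₃, t₀₁ + t₁₃] = 0`. [folklore] -/
theorem commute_t03_t01_add_t13 : Commute (t R N (0 : Fin 4) 3) (t R N 0 1 + t R N 1 3) := by
  have h := t_mul_add (R := R) (N := N) (0 : Fin 4) 3 1 (by decide) (by decide) (by decide)
  rw [t_31] at h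
  exact h

/-- `[t₂₃, t₀₂ + t₀₃] = 0`. [folklore] -/
theorem commute_t23_t02_add_t03 : Commute (t R N (2 : Fin 4) 3) (t R N 0 2 + t R N 0 3) := by
  have h := t_mul_add (R := R) (N := N) (2 : Fin 4) 3 0 (by decide) (by decide) (by decide)
  rw [t_20, t_30] at h
  exact h

end FourStrands

end DrinfeldKohnoTrunc

/-! ## 2. Permuted pentagons -/

namespace NCSeries

section PentagonPerm

variable {k : Type u} [CommRing k] {N : ℕ}

local notation "𝔱" => (DrinfeldKohnoTrunc.t k N : Fin 4 → Fin 4 → DrinfeldKohnoTrunc k (Fin 4) N)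

/-- Algebra endomorphisms commute with `φ(a, b)`. [folklore] -/
theorem algHom_evalTrunc_bsub {A B : Type*} [Ring A] [Algebra k A] [Ring B] [Algebra k B]
    (F : A →ₐ[k] B) (N : ℕ) (φ : NCSeries Bool k) (a b : A) :
    F (evalTrunc N (bsub a b) φ) = evalTrunc N (bsub (F a) (F b)) φ := by
  rw [algHom_evalTrunc, comp_bsub]

/-- **The pentagon for an arbitrary ordering `(P,Q,R,S) = (σ0,σ1,σ2,σ3)` of the strands**:
`φ(t_{PQ}, t_{QR} + t_{QS}) φ(t_{PR} + t_{QR}, t_{RS}) = φ(t_{QR}, t_{RS}) φ(t_{PQ} + t_{PR}, t_{QS} + t_{RS}) φ(t_{PQ}, t_{QR})`,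
the image of the pentagon under the `S₄`-action. [cite: Furusho2010, §1 (1)] -/
theorem DrinfeldPentagon.perm {φ : NCSeries Bool k} (h : DrinfeldPentagon φ)
    (σ : Equiv.Perm (Fin 4)) :
    evalTrunc N (bsub (𝔱 (σ 0) (σ 1)) (𝔱 (σ 1) (σ 2) + 𝔱 (σ 1) (σ 3))) φ *
        evalTrunc N (bsub (𝔱 (σ 0) (σ 2) + 𝔱 (σ 1) (σ 2)) (𝔱 (σ 2) (σ 3))) φ =
      evalTrunc N (bsub (𝔱 (σ 1) (σ 2)) (𝔱 (σ 2) (σ 3))) φ *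
          evalTrunc N (bsub (𝔱 (σ 0) (σ 1) + 𝔱 (σ 0) (σ 2)) (𝔱 (σ 1) (σ 3) + 𝔱 (σ 2) (σ 3))) φ *
        evalTrunc N (bsub (𝔱 (σ 0) (σ 1)) (𝔱 (σ 1) (σ 2))) φ := by
  have h' := congrArg (DrinfeldKohnoTrunc.permHom (R := k) (N := N) σ) (h N)
  dsimp only [subst₂, t₄] at h'
  simpa only [map_mul, algHom_evalTrunc_bsub, map_add, DrinfeldKohnoTrunc.permHom_t] using h'

/-- The pentagon for the ordering `(A,B,D,C) = (0,1,3,2)`: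
`Φ^{A,B,DC} Φ^{AB,D,C} = Φ^{B,D,C} Φ^{A,BD,C} Φ^{A,B,D}`. [cite: Furusho2010, §1 (1)] -/
theorem DrinfeldPentagon.pent_ABDC {φ : NCSeries Bool k} (h : DrinfeldPentagon φ) :
    evalTrunc N (bsub (𝔱 0 1) (𝔱 1 2 + 𝔱 1 3)) φ * evalTrunc N (bsub (𝔱 0 3 + 𝔱 1 3) (𝔱 2 3)) φ =
      evalTrunc N (bsub (𝔱 1 3) (𝔱 2 3)) φ *
          evalTrunc N (bsub (𝔱 0 1 + 𝔱 0 3) (𝔱 1 2 + 𝔱 2 3)) φ *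
        evalTrunc N (bsub (𝔱 0 1) (𝔱 1 3)) φ := by
  have h' := h.perm (N := N) DrinfeldKohnoTrunc.s₂₃
  simp only [DrinfeldKohnoTrunc.s₂₃_0, DrinfeldKohnoTrunc.s₂₃_1, DrinfeldKohnoTrunc.s₂₃_2,
    DrinfeldKohnoTrunc.s₂₃_3, DrinfeldKohnoTrunc.t_32] at h'
  rw [add_comm (𝔱 1 3) (𝔱 1 2)] at h'
  exact h'

/-- The pentagon for the ordering `(A,D,B,C) = (0,3,1,2)`:
`Φ^{A,D,BC} Φ^{AD,B,C} = Φ^{D,B,C} Φ^{A,DB,C} Φ^{A,D,B}`. [cite: Furusho2010, §1 (1)] -/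
theorem DrinfeldPentagon.pent_ADBC {φ : NCSeries Bool k} (h : DrinfeldPentagon φ) :
    evalTrunc N (bsub (𝔱 0 3) (𝔱 1 3 + 𝔱 2 3)) φ * evalTrunc N (bsub (𝔱 0 1 + 𝔱 1 3) (𝔱 1 2)) φ =
      evalTrunc N (bsub (𝔱 1 3) (𝔱 1 2)) φ *
          evalTrunc N (bsub (𝔱 0 1 + 𝔱 0 3) (𝔱 1 2 + 𝔱 2 3)) φ *
        evalTrunc N (bsub (𝔱 0 3) (𝔱 1 3)) φ := by
  have h' := h.perm (N := N) DrinfeldKohnoTrunc.pADBC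
  simp only [DrinfeldKohnoTrunc.pADBC_0, DrinfeldKohnoTrunc.pADBC_1, DrinfeldKohnoTrunc.pADBC_2,
    DrinfeldKohnoTrunc.pADBC_3, DrinfeldKohnoTrunc.t_31, DrinfeldKohnoTrunc.t_32] at h'
  rw [add_comm (𝔱 0 3) (𝔱 0 1), add_comm (𝔱 2 3) (𝔱 1 2)] at h'
  exact h'

/-- The pentagon for the ordering `(D,A,B,C) = (3,0,1,2)`:
`Φ^{D,A,BC} Φ^{DA,B,C} = Φ^{A,B,C} Φ^{D,AB,C} Φ^{D,A,B}`. [cite: Furusho2010, §1 (1)] -/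
theorem DrinfeldPentagon.pent_DABC {φ : NCSeries Bool k} (h : DrinfeldPentagon φ) :
    evalTrunc N (bsub (𝔱 0 3) (𝔱 0 1 + 𝔱 0 2)) φ * evalTrunc N (bsub (𝔱 0 1 + 𝔱 1 3) (𝔱 1 2)) φ =
      evalTrunc N (bsub (𝔱 0 1) (𝔱 1 2)) φ *
          evalTrunc N (bsub (𝔱 0 3 + 𝔱 1 3) (𝔱 0 2 + 𝔱 1 2)) φ *
        evalTrunc N (bsub (𝔱 0 3) (𝔱 0 1)) φ := by
  have h' := h.perm (N := N) DrinfeldKohnoTrunc.pDABC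
  simp only [DrinfeldKohnoTrunc.pDABC_0, DrinfeldKohnoTrunc.pDABC_1, DrinfeldKohnoTrunc.pDABC_2,
    DrinfeldKohnoTrunc.pDABC_3, DrinfeldKohnoTrunc.t_30, DrinfeldKohnoTrunc.t_31] at h'
  rw [add_comm (𝔱 1 3) (𝔱 0 1)] at h'
  exact h'

end PentagonPerm

/-! ## 3. Units: `φ(a,b)` and `e^{μ x/2}` -/

section UnitsDK

variable {k : Type u} [CommRing k] [Algebra ℚ k] {N : ℕ}

open Classical in
/-- `φ(a, b)` as a unit of `U𝔞₄ ⊗ k/(deg > N)` (a genuine unit when `c_∅(φ) = 1` and `a, b` are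
weight-one; `1` otherwise, an irrelevant default). [folklore] -/
def phiU (N : ℕ) (φ : NCSeries Bool k) (a b : DrinfeldKohnoTrunc k (Fin 4) N) :
    (DrinfeldKohnoTrunc k (Fin 4) N)ˣ :=
  if h : IsUnit (evalTrunc N (bsub a b) φ) then h.unit else 1

omit [Algebra ℚ k] in
/-- The value of `phiU`. [folklore] -/
theorem phiU_val {φ : NCSeries Bool k} (h1 : φ [] = 1) {a b : DrinfeldKohnoTrunc k (Fin 4) N}
    (ha : a ∈ (DrinfeldKohnoTrunc.genSpan : Submodule k (DrinfeldKohnoTrunc k (Fin 4) N)))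
    (hb : b ∈ (DrinfeldKohnoTrunc.genSpan : Submodule k (DrinfeldKohnoTrunc k (Fin 4) N))) :
    (phiU N φ a b : DrinfeldKohnoTrunc k (Fin 4) N) = evalTrunc N (bsub a b) φ := by
  have hu : IsUnit (evalTrunc N (bsub a b) φ) := isUnit_subst₂ h1 ha hb
  rw [phiU, dif_pos hu]
  exact hu.unit_spec

/-- `(μ/2) x` is nilpotent of order `N + 1` for weight-one `x`. [folklore] -/
theorem half_smul_pow_eq_zero (μ : k) {x : DrinfeldKohnoTrunc k (Fin 4) N}
    (hx : x ∈ (DrinfeldKohnoTrunc.genSpan : Submodule k (DrinfeldKohnoTrunc k (Fin 4) N))) :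
    (((1 / 2 : ℚ) • μ) • x) ^ (N + 1) = 0 := by
  rw [smul_pow, DrinfeldKohnoTrunc.pow_eq_zero_of_mem_genSpan hx, smul_zero]

/-- `e^{μ x/2}` as a unit of `U𝔞₄ ⊗ k/(deg > N)` for weight-one `x`, with inverse `e^{-μ x/2}`.
[folklore] -/
def expU (μ : k) (x : DrinfeldKohnoTrunc k (Fin 4) N)
    (hx : x ∈ (DrinfeldKohnoTrunc.genSpan : Submodule k (DrinfeldKohnoTrunc k (Fin 4) N))) :
    (DrinfeldKohnoTrunc k (Fin 4) N)ˣ :=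
  ⟨DrinfeldKohnoTrunc.expT (((1 / 2 : ℚ) • μ) • x), DrinfeldKohnoTrunc.expT (-(((1 / 2 : ℚ) • μ) • x)),
    by rw [DrinfeldKohnoTrunc.expT_eq_truncExp, DrinfeldKohnoTrunc.expT_eq_truncExp]
       exact truncExp_mul_truncExp_neg N (half_smul_pow_eq_zero μ hx),
    by rw [DrinfeldKohnoTrunc.expT_eq_truncExp, DrinfeldKohnoTrunc.expT_eq_truncExp]
       exact truncExp_neg_mul_truncExp N (half_smul_pow_eq_zero μ hx)⟩

/-- The value of `expU`. [folklore] -/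
@[simp] theorem expU_val (μ : k) (x : DrinfeldKohnoTrunc k (Fin 4) N)
    (hx : x ∈ (DrinfeldKohnoTrunc.genSpan : Submodule k (DrinfeldKohnoTrunc k (Fin 4) N))) :
    (expU μ x hx : DrinfeldKohnoTrunc k (Fin 4) N) = DrinfeldKohnoTrunc.expT (((1 / 2 : ℚ) • μ) • x) :=
  rfl

/-- `e^{μ x/2}` commutes with `φ(a, b)` when `x` commutes with `a` and `b`. [folklore] -/
theorem commute_expT_evalTrunc (μ : k) {x a b : DrinfeldKohnoTrunc k (Fin 4) N} (ha : Commute x a)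
    (hb : Commute x b) (φ : NCSeries Bool k) :
    Commute (DrinfeldKohnoTrunc.expT (((1 / 2 : ℚ) • μ) • x)) (evalTrunc N (bsub a b) φ) := by
  have h : Commute (((1 / 2 : ℚ) • μ) • x) (evalTrunc N (bsub a b) φ) :=
    (commute_evalTrunc_bsub ha hb N φ).smul_left _
  rw [DrinfeldKohnoTrunc.expT_eq_truncExp]
  exact (Commute.truncExp_right (R := k) h.symm N).symm

end UnitsDK

/-! ## 4. The coherence identity -/

section Coherence

variable {k : Type u} [CommRing k] [Algebra ℚ k] {N : ℕ}

local notation "𝔱" => (DrinfeldKohnoTrunc.t k N : Fin 4 → Fin 4 → DrinfeldKohnoTrunc k (Fin 4) N)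

/-- **The pentagon coherence identity for a strand moving over the block `(01)2`**
[cite: Furusho2010, §1 (1)–(2); Drinfeld1991, §5]: for a solution `φ` of the pentagon with
`c_∅(φ) = 1` and any `μ`, writing `Φ^{P,Q,S} = φ(t_{PQ}, t_{QS})` for blocks and
`E^{PQ} = exp{μ t_{PQ}/2}` (`A,B,C,D = 0,1,2,3`),
`Φ^{D,AB,C} [Φ^{D,A,B} E^{AD} (Φ^{A,D,B})⁻¹ E^{BD} Φ^{A,B,D}] (Φ^{AB,D,C})⁻¹ E^{CD} Φ^{AB,C,D}`
`= (Φ^{A,B,C})⁻¹ Φ^{D,A,BC} E^{AD} (Φ^{A,D,BC})⁻¹ [Φ^{D,B,C} E^{BD} (Φ^{B,D,C})⁻¹ E^{CD} Φ^{B,C,D}] Φ^{A,BC,D} Φ^{A,B,C}`.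
Both sides are the composite "move `D` past `C`, then `B`, then `A`" computed along two
re-association routes; they agree by the pentagons for the orderings `ABCD, ABDC, ADBC, DABC`
and the commutations `[t_{CD}, Φ^{A,B,CD}] = [t_{BD}, Φ^{A,BD,C}] = [t_{AD}, Φ^{AD,B,C}] = 0`.
[cite: Furusho2010, §1] -/
theorem DrinfeldPentagon.coherence {φ : NCSeries Bool k} (hP : DrinfeldPentagon φ) (h1 : φ [] = 1)
    (μ : k) :
    evalTrunc N (bsub (𝔱 0 3 + 𝔱 1 3) (𝔱 0 2 + 𝔱 1 2)) φ *
            (evalTrunc N (bsub (𝔱 0 3) (𝔱 0 1)) φ *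
                    DrinfeldKohnoTrunc.expT (((1 / 2 : ℚ) • μ) • 𝔱 0 3) *
                  Ring.inverse (evalTrunc N (bsub (𝔱 0 3) (𝔱 1 3)) φ) *
                DrinfeldKohnoTrunc.expT (((1 / 2 : ℚ) • μ) • 𝔱 1 3) *
              evalTrunc N (bsub (𝔱 0 1) (𝔱 1 3)) φ) *
          Ring.inverse (evalTrunc N (bsub (𝔱 0 3 + 𝔱 1 3) (𝔱 2 3)) φ) *
        DrinfeldKohnoTrunc.expT (((1 / 2 : ℚ) • μ) • 𝔱 2 3) *
      evalTrunc N (bsub (𝔱 0 2 + 𝔱 1 2) (𝔱 2 3)) φ =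
    Ring.inverse (evalTrunc N (bsub (𝔱 0 1) (𝔱 1 2)) φ) *
                evalTrunc N (bsub (𝔱 0 3) (𝔱 0 1 + 𝔱 0 2)) φ *
              DrinfeldKohnoTrunc.expT (((1 / 2 : ℚ) • μ) • 𝔱 0 3) *
            Ring.inverse (evalTrunc N (bsub (𝔱 0 3) (𝔱 1 3 + 𝔱 2 3)) φ) *
          (evalTrunc N (bsub (𝔱 1 3) (𝔱 1 2)) φ *
                  DrinfeldKohnoTrunc.expT (((1 / 2 : ℚ) • μ) • 𝔱 1 3) *
                Ring.inverse (evalTrunc N (bsub (𝔱 1 3) (𝔱 2 3)) φ) *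
              DrinfeldKohnoTrunc.expT (((1 / 2 : ℚ) • μ) • 𝔱 2 3) *
            evalTrunc N (bsub (𝔱 1 2) (𝔱 2 3)) φ) *
        evalTrunc N (bsub (𝔱 0 1 + 𝔱 0 2) (𝔱 1 3 + 𝔱 2 3)) φ *
      evalTrunc N (bsub (𝔱 0 1) (𝔱 1 2)) φ := by
  -- memberships
  have m01 := DrinfeldKohnoTrunc.t_mem_genSpan (R := k) (N := N) (0 : Fin 4) 1
  have m02 := DrinfeldKohnoTrunc.t_mem_genSpan (R := k) (N := N) (0 : Fin 4) 2
  have m03 := DrinfeldKohnoTrunc.t_mem_genSpan (R := k) (N := N) (0 : Fin 4) 3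
  have m12 := DrinfeldKohnoTrunc.t_mem_genSpan (R := k) (N := N) (1 : Fin 4) 2
  have m13 := DrinfeldKohnoTrunc.t_mem_genSpan (R := k) (N := N) (1 : Fin 4) 3
  have m23 := DrinfeldKohnoTrunc.t_mem_genSpan (R := k) (N := N) (2 : Fin 4) 3
  have m0313 := DrinfeldKohnoTrunc.t_add_t_mem_genSpan (R := k) (N := N) 0 3 1 3
  have m0212 := DrinfeldKohnoTrunc.t_add_t_mem_genSpan (R := k) (N := N) 0 2 1 2
  have m0102 := DrinfeldKohnoTrunc.t_add_t_mem_genSpan (R := k) (N := N) 0 1 0 2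
  have m1323 := DrinfeldKohnoTrunc.t_add_t_mem_genSpan (R := k) (N := N) 1 3 2 3
  have m1213 := DrinfeldKohnoTrunc.t_add_t_mem_genSpan (R := k) (N := N) 1 2 1 3
  have m0103 := DrinfeldKohnoTrunc.t_add_t_mem_genSpan (R := k) (N := N) 0 1 0 3
  have m1223 := DrinfeldKohnoTrunc.t_add_t_mem_genSpan (R := k) (N := N) 1 2 2 3
  have m0113 := DrinfeldKohnoTrunc.t_add_t_mem_genSpan (R := k) (N := N) 0 1 1 3
  -- the units (dictionary of `coherence_group`)
  have key := coherence_group (G := (DrinfeldKohnoTrunc k (Fin 4) N)ˣ)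
    (a := phiU N φ (𝔱 0 1) (𝔱 1 2)) (b := phiU N φ (𝔱 0 3 + 𝔱 1 3) (𝔱 0 2 + 𝔱 1 2))
    (c := phiU N φ (𝔱 0 3) (𝔱 0 1)) (d := phiU N φ (𝔱 0 3) (𝔱 1 3))
    (f := phiU N φ (𝔱 0 1) (𝔱 1 3)) (g := phiU N φ (𝔱 0 3 + 𝔱 1 3) (𝔱 2 3))
    (h := phiU N φ (𝔱 0 2 + 𝔱 1 2) (𝔱 2 3)) (i := phiU N φ (𝔱 0 3) (𝔱 0 1 + 𝔱 0 2))
    (j := phiU N φ (𝔱 0 3) (𝔱 1 3 + 𝔱 2 3)) (l := phiU N φ (𝔱 1 3) (𝔱 1 2))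
    (m := phiU N φ (𝔱 1 3) (𝔱 2 3)) (n := phiU N φ (𝔱 1 2) (𝔱 2 3))
    (o := phiU N φ (𝔱 0 1 + 𝔱 0 2) (𝔱 1 3 + 𝔱 2 3)) (p := phiU N φ (𝔱 0 1) (𝔱 1 2 + 𝔱 1 3))
    (q := phiU N φ (𝔱 0 1 + 𝔱 0 3) (𝔱 1 2 + 𝔱 2 3)) (r := phiU N φ (𝔱 0 1 + 𝔱 1 3) (𝔱 1 2))
    (eAD := expU μ (𝔱 0 3) m03) (eBD := expU μ (𝔱 1 3) m13) (eCD := expU μ (𝔱 2 3) m23)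
    (Units.ext (by
      simp only [Units.val_mul, phiU_val h1 m01 m1213, phiU_val h1 m0212 m23, phiU_val h1 m12 m23,
        phiU_val h1 m0102 m1323, phiU_val h1 m01 m12]
      have e := hP N
      dsimp only [subst₂, t₄] at e
      exact e))
    (Units.ext (by
      simp only [Units.val_mul, phiU_val h1 m01 m1213, phiU_val h1 m0313 m23, phiU_val h1 m13 m23,
        phiU_val h1 m0103 m1223, phiU_val h1 m01 m13]
      exact hP.pent_ABDC))
    (Units.ext (by
      simp only [Units.val_mul, phiU_val h1 m03 m1323, phiU_val h1 m0113 m12, phiU_val h1 m13 m12,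
        phiU_val h1 m0103 m1223, phiU_val h1 m03 m13]
      exact hP.pent_ADBC))
    (Units.ext (by
      simp only [Units.val_mul, phiU_val h1 m03 m0102, phiU_val h1 m0113 m12, phiU_val h1 m01 m12,
        phiU_val h1 m0313 m0212, phiU_val h1 m03 m01]
      exact hP.pent_DABC))
    (Units.ext (by
      simp only [Units.val_mul, expU_val, phiU_val h1 m01 m1213]
      exact (commute_expT_evalTrunc μ DrinfeldKohnoTrunc.commute_t01_t23.symm
        DrinfeldKohnoTrunc.commute_t23_t12_add_t13 φ).eq))
    (Units.ext (by
      simp only [Units.val_mul, expU_val, phiU_val h1 m0103 m1223]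
      exact (commute_expT_evalTrunc μ DrinfeldKohnoTrunc.commute_t13_t01_add_t03
        DrinfeldKohnoTrunc.commute_t13_t12_add_t23 φ).eq))
    (Units.ext (by
      simp only [Units.val_mul, expU_val, phiU_val h1 m0113 m12]
      exact (commute_expT_evalTrunc μ DrinfeldKohnoTrunc.commute_t03_t01_add_t13
        DrinfeldKohnoTrunc.commute_t03_t12 φ).eq))
  have key' := congrArg Units.val key
  simpa only [Units.val_mul, ← Ring.inverse_unit, expU_val, mul_assoc, phiU_val h1 m01 m12,
    phiU_val h1 m0313 m0212, phiU_val h1 m03 m01, phiU_val h1 m03 m13, phiU_val h1 m01 m13,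
    phiU_val h1 m0313 m23, phiU_val h1 m0212 m23, phiU_val h1 m03 m0102, phiU_val h1 m03 m1323,
    phiU_val h1 m13 m12, phiU_val h1 m13 m23, phiU_val h1 m12 m23, phiU_val h1 m0102 m1323]
    using key'

end Coherence

end NCSeries

end Literature.NumberTheory.Transcendental
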